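import Summits.Ventures.PercRepro.C026
import Summits.Ventures.PercRepro.C026FreeStep

/-!
# C-026 from the contraction condition, in the literal `C026` shape (p5, gen 8)

The two bridges of `C026Recursion` / `C026FreeStep` restated with the conclusion `C026` of
`C026.lean`, and the identification of the slack with the quadratic form of `kernel26`:

* **`slack26_eq_quadForm`** — `slack26 = G.quadForm p ![a, b, c] kernel26`;
* **`C026_of_conCEdges`** — `ConCEdges → C026` ((Con) at every non-loop edge at `c`);
* **`C026_of_conCNonMarkEdges`** — `ConCNonMarkEdges → C026` (mine-3's censused (Con)_cv).
-/

namespace PercRepro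

namespace MultiGraph

variable {V E : Type*} (G : MultiGraph V E) [Fintype E] [DecidableEq E]

/-- The C-026 slack is the quadratic form of `kernel26` at the law. -/
theorem slack26_eq_quadForm (p : E → ℝ) (a b c : V) :
    G.slack26 p a b c = G.quadForm p ![a, b, c] kernel26 := by
  rw [G.quadForm_kernel26]
  rfl

end MultiGraph

/-- **(Con) at every non-loop edge at `c` gives C-026** (the bridge of record, lead 2082 (1)). -/
theorem C026_of_conCEdges (h : ConCEdges) : C026 :=
  fun G p hp a b c => c026_rows_of_conCEdges h G p hp a b c

/-- **Mine-3's censused (Con)_cv gives C-026**: (Con) at every c–non-mark edge of every marked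
multigraph implies C-026 for every multigraph, `p ∈ [0,1]^E` and marks. -/
theorem C026_of_conCNonMarkEdges (h : ConCNonMarkEdges) : C026 :=
  fun G p hp a b c => c026_rows_of_conCNonMarkEdges h G p hp a b c

end PercRepro
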